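import Mathlib.LinearAlgebra.Lagrange
import Mathlib.LinearAlgebra.Matrix.Charpoly.Coeff
import Mathlib.LinearAlgebra.Matrix.ToLinearEquiv
import Mathlib.RingTheory.Idempotents
import HarnessLib

/-!
# Lagrange spectral projections of a matrix with simple spectrum

For a square matrix `M` over a field whose characteristic polynomial splits with pairwise
distinct roots `μₐ` (`charpoly M = ∏ₐ (X - μₐ)`), the **Lagrange interpolation polynomials**
`ℓₐ = ∏_{b ≠ a} (X - μ_b)/(μₐ - μ_b)` evaluated at `M`,

  `Πₐ = ℓₐ(M) = ∏_{b ≠ a} (M - μ_b)/(μₐ - μ_b)`  (`lagrangeProj`),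

are the spectral projections of `M`: they form a complete family of orthogonal idempotents
(`completeOrthogonalIdempotents_lagrangeProj`: `Σₐ Πₐ = 1` is `Σₐ ℓₐ = 1`, Mathlib's
`Lagrange.sum_basis`; `ΠₐΠ_b = 0` for `a ≠ b` because `ℓₐℓ_b` is a multiple of the
characteristic polynomial, by Cayley–Hamilton), `MΠₐ = μₐΠₐ` (`mul_lagrangeProj`), hence
`M = Σₐ μₐ Πₐ` (`eq_sum_smul_lagrangeProj`), and each `Πₐ ≠ 0` (`lagrangeProj_ne_zero`: `μₐ`
has an eigenvector `v`, and `Πₐv = ℓₐ(μₐ)v = v`). This is the representation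
`A = Σⱼ λⱼEⱼ`, `Eⱼ = ∏_{k ≠ j} (A - λ_kI)/(λⱼ - λ_k)` of [BrennerThomeeWahlbin1975, Ch. 5 §1,
proof of Lemma 1.2] ("where `Eⱼ` are mutually orthogonal hermitean projections given by …"),
valid for any diagonalizable matrix with distinct eigenvalues `λⱼ` — here in the simple-spectrum
case, where diagonalizability is automatic. Since the `Πₐ` are explicit polynomials in `M` and
the `μ_b`, they depend smoothly on parameters when `M` and the `μ_b` do
(`lagrangeProj_eq_list_prod`); this is how the smooth spectral decomposition of a strictly
hyperbolic pencil near a point is obtained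
(`Literature/LinearAlgebra/Matrix/StrictlyHyperbolicPencil.lean`).

## References

* [BrennerThomeeWahlbin1975] P. Brenner, V. Thomée, L. B. Wahlbin, LNM 434 (1975), Ch. 5 §1,
  proof of Lemma 1.2 (spectral projections as Lagrange polynomials).
-/

noncomputable section

open Polynomial Finset Lagrange

namespace Literature.LinearAlgebra.Matrix

variable {𝕜 : Type*} [Field 𝕜] {n ι : Type*} [Fintype n] [DecidableEq n] [Fintype ι]
  [DecidableEq ι]

/-- **Lagrange spectral projection** `Πₐ = ℓₐ(M)`, `ℓₐ = ∏_{b ≠ a} (X - μ_b)/(μₐ - μ_b)` the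
Lagrange basis polynomial at the nodes `μ`.
[cite: BrennerThomeeWahlbin1975, Ch. 5 §1, proof of Lemma 1.2] -/
def lagrangeProj (M : Matrix n n 𝕜) (μ : ι → 𝕜) (a : ι) : Matrix n n 𝕜 :=
  aeval M (Lagrange.basis univ μ a)

variable {M : Matrix n n 𝕜} {μ : ι → 𝕜}

omit [DecidableEq ι] in
/-- Under `charpoly M = ∏ₐ (X - μₐ)`: `charpoly M = nodal univ μ`. [folklore] -/
theorem charpoly_eq_nodal (hchar : M.charpoly = ∏ a, (X - C (μ a))) :
    M.charpoly = nodal univ μ := by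
  rw [hchar, nodal_eq]

omit [DecidableEq ι] in
/-- Cayley–Hamilton: `(nodal univ μ)(M) = ∏ₐ (M - μₐ) = 0`. [folklore] -/
theorem aeval_nodal_eq_zero (hchar : M.charpoly = ∏ a, (X - C (μ a))) :
    aeval M (nodal univ μ) = 0 := by
  rw [← charpoly_eq_nodal hchar]
  exact Matrix.aeval_self_charpoly M

/-- **Completeness**: `Σₐ Πₐ = 1` (`Σₐ ℓₐ = 1`). [cite: BrennerThomeeWahlbin1975, Ch. 5 §1, proof of Lemma 1.2] -/
theorem sum_lagrangeProj (hμ : Function.Injective μ)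
    (hchar : M.charpoly = ∏ a, (X - C (μ a))) : ∑ a, lagrangeProj M μ a = 1 := by
  rcases isEmpty_or_nonempty ι with hι | hι
  · -- then `charpoly M = 1`, so `n` is empty and the matrix ring is trivial
    have hcard : Fintype.card n = 0 := by
      have h := congr_arg Polynomial.natDegree hchar
      rwa [Matrix.charpoly_natDegree_eq_dim, univ_eq_empty, prod_empty, natDegree_one] at h
    haveI : IsEmpty n := Fintype.card_eq_zero_iff.1 hcard
    exact Subsingleton.elim _ _
  · unfold lagrangeProj
    rw [← map_sum, sum_basis hμ.injOn univ_nonempty, map_one]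

/-- **Orthogonality**: `ΠₐΠ_b = 0` for `a ≠ b` (`ℓₐℓ_b` is a multiple of `∏ (X - μ_c)`, which
annihilates `M`). [cite: BrennerThomeeWahlbin1975, Ch. 5 §1, proof of Lemma 1.2] -/
theorem lagrangeProj_mul_lagrangeProj_of_ne (hchar : M.charpoly = ∏ a, (X - C (μ a))) {a b : ι}
    (hab : a ≠ b) : lagrangeProj M μ a * lagrangeProj M μ b = 0 := by
  have hb : b ∈ univ.erase a := mem_erase.2 ⟨Ne.symm hab, mem_univ b⟩
  have hdvd : nodal univ μ ∣ Lagrange.basis univ μ a * Lagrange.basis univ μ b := by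
    rw [basis_eq_prod_sub_inv_mul_nodal_div (mem_univ a),
      basis_eq_prod_sub_inv_mul_nodal_div (mem_univ b), ← nodal_erase_eq_nodal_div (mem_univ a),
      ← nodal_erase_eq_nodal_div (mem_univ b), nodal_eq_mul_nodal_erase hb]
    conv_lhs => rw [nodal_eq_mul_nodal_erase (mem_univ b)]
    exact Dvd.intro (C (nodalWeight univ μ a) * nodal ((univ.erase a).erase b) μ *
      C (nodalWeight univ μ b)) (by ring)
  obtain ⟨q, hq⟩ := hdvd
  unfold lagrangeProj
  rw [← map_mul, hq, map_mul, aeval_nodal_eq_zero hchar, zero_mul]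

/-- **Eigen-relation**: `M Πₐ = μₐ Πₐ` (`(X - μₐ)ℓₐ` is a multiple of `∏ (X - μ_c)`).
[cite: BrennerThomeeWahlbin1975, Ch. 5 §1, proof of Lemma 1.2] -/
theorem mul_lagrangeProj (hchar : M.charpoly = ∏ a, (X - C (μ a))) (a : ι) :
    M * lagrangeProj M μ a = μ a • lagrangeProj M μ a := by
  have h : (X - C (μ a)) * Lagrange.basis univ μ a = C (nodalWeight univ μ a) * nodal univ μ := by
    rw [basis_eq_prod_sub_inv_mul_nodal_div (mem_univ a), ← nodal_erase_eq_nodal_div (mem_univ a)]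
    conv_rhs => rw [nodal_eq_mul_nodal_erase (mem_univ a)]
    ring
  have h2 := congr_arg (aeval M) h
  rw [map_mul, map_mul, aeval_nodal_eq_zero hchar, mul_zero, map_sub, aeval_X, aeval_C, sub_mul,
    sub_eq_zero] at h2
  rw [lagrangeProj, h2, Algebra.algebraMap_eq_smul_one, smul_mul_assoc, one_mul]

/-- Polynomials in `M` commute with `M`. [folklore] -/
theorem lagrangeProj_commute (M : Matrix n n 𝕜) (μ : ι → 𝕜) (a : ι) :
    Commute (lagrangeProj M μ a) M := by
  change lagrangeProj M μ a * M = M * lagrangeProj M μ a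
  unfold lagrangeProj
  have hX : aeval M (Lagrange.basis univ μ a * X) = aeval M (X * Lagrange.basis univ μ a) := by
    rw [mul_comm]
  rwa [map_mul, map_mul, aeval_X] at hX

/-- `Πₐ M = μₐ Πₐ` as well. [folklore] -/
theorem lagrangeProj_mul (hchar : M.charpoly = ∏ a, (X - C (μ a))) (a : ι) :
    lagrangeProj M μ a * M = μ a • lagrangeProj M μ a := by
  rw [(lagrangeProj_commute M μ a).eq, mul_lagrangeProj hchar a]

/-- **Idempotence**: `Πₐ² = Πₐ` (from `Πₐ = Πₐ Σ_b Π_b`). [cite: BrennerThomeeWahlbin1975, Ch. 5 §1, proof of Lemma 1.2] -/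
theorem lagrangeProj_mul_self (hμ : Function.Injective μ)
    (hchar : M.charpoly = ∏ a, (X - C (μ a))) (a : ι) :
    lagrangeProj M μ a * lagrangeProj M μ a = lagrangeProj M μ a := by
  have h := congr_arg (fun N => lagrangeProj M μ a * N) (sum_lagrangeProj hμ hchar)
  simp only [mul_sum, mul_one] at h
  rw [sum_eq_single a] at h
  · exact h
  · intro b _ hba
    exact lagrangeProj_mul_lagrangeProj_of_ne hchar (Ne.symm hba)
  · intro ha; exact absurd (mem_univ a) ha

/-- **The Lagrange projections are complete orthogonal idempotents.**
[cite: BrennerThomeeWahlbin1975, Ch. 5 §1, proof of Lemma 1.2] -/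
theorem completeOrthogonalIdempotents_lagrangeProj (hμ : Function.Injective μ)
    (hchar : M.charpoly = ∏ a, (X - C (μ a))) :
    CompleteOrthogonalIdempotents (lagrangeProj M μ) where
  idem a := lagrangeProj_mul_self hμ hchar a
  ortho _ _ hab := lagrangeProj_mul_lagrangeProj_of_ne hchar hab
  complete := sum_lagrangeProj hμ hchar

/-- **Spectral decomposition** `M = Σₐ μₐ Πₐ`. [cite: BrennerThomeeWahlbin1975, Ch. 5 §1, proof of Lemma 1.2] -/
theorem eq_sum_smul_lagrangeProj (hμ : Function.Injective μ)
    (hchar : M.charpoly = ∏ a, (X - C (μ a))) : M = ∑ a, μ a • lagrangeProj M μ a := by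
  calc M = M * ∑ a, lagrangeProj M μ a := by rw [sum_lagrangeProj hμ hchar, mul_one]
    _ = ∑ a, μ a • lagrangeProj M μ a := by
        rw [mul_sum]
        exact sum_congr rfl fun a _ => mul_lagrangeProj hchar a

/-- A polynomial in `M` acts on an eigenvector by the scalar `q(μ)`. [folklore] -/
theorem aeval_mulVec_of_eigenvector {v : n → 𝕜} {c : 𝕜} (hv : M.mulVec v = c • v) (q : 𝕜[X]) :
    (aeval M q).mulVec v = q.eval c • v := by
  have hpow : ∀ j : ℕ, (M ^ j).mulVec v = c ^ j • v := by
    intro j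
    induction j with
    | zero => simp
    | succ j ih => rw [pow_succ, ← Matrix.mulVec_mulVec, hv, Matrix.mulVec_smul, ih, smul_smul,
        pow_succ, mul_comm]
  induction q using Polynomial.induction_on' with
  | add p q hp hq => rw [map_add, Matrix.add_mulVec, hp, hq, eval_add, add_smul]
  | monomial j b =>
      rw [aeval_monomial, Algebra.algebraMap_eq_smul_one, smul_mul_assoc, one_mul,
        Matrix.smul_mulVec, hpow, smul_smul, eval_monomial]

/-- **Non-degeneracy**: each `Πₐ ≠ 0` — `μₐ` is a root of the characteristic polynomial, so it
has an eigenvector `v ≠ 0`, and `Πₐ v = ℓₐ(μₐ) v = v`. [folklore] -/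
theorem lagrangeProj_ne_zero (hμ : Function.Injective μ)
    (hchar : M.charpoly = ∏ a, (X - C (μ a))) (a : ι) : lagrangeProj M μ a ≠ 0 := by
  have hroot : M.charpoly.IsRoot (μ a) := by
    rw [hchar, IsRoot.def, eval_prod]
    exact prod_eq_zero (mem_univ a) (by simp)
  rw [IsRoot.def, Matrix.eval_charpoly, ← Matrix.exists_mulVec_eq_zero_iff] at hroot
  obtain ⟨v, hv0, hv⟩ := hroot
  have hMv : M.mulVec v = μ a • v := by
    rw [Matrix.sub_mulVec, sub_eq_zero] at hv
    rw [← hv]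
    ext i
    simp [Matrix.scalar_apply, Matrix.mulVec_diagonal]
  intro hzero
  have key := aeval_mulVec_of_eigenvector hMv (Lagrange.basis univ μ a)
  rw [eval_basis_self hμ.injOn (mem_univ a), one_smul] at key
  change (lagrangeProj M μ a).mulVec v = v at key
  rw [hzero, Matrix.zero_mulVec] at key
  exact hv0 key.symm

/-- The range of `Πₐ` consists of eigenvectors: `M(Πₐ w) = μₐ Πₐ w`. [folklore] -/
theorem mulVec_lagrangeProj_mulVec (hchar : M.charpoly = ∏ a, (X - C (μ a))) (a : ι)
    (w : n → 𝕜) : M.mulVec ((lagrangeProj M μ a).mulVec w) = μ a • (lagrangeProj M μ a).mulVec w := by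
  rw [Matrix.mulVec_mulVec, mul_lagrangeProj hchar a, Matrix.smul_mulVec]

/-! ### The projections as explicit products -/

/-- `ℓₐ(M)` for a single Lagrange factor: `((μₐ - μ_b)⁻¹(X - μ_b))(M) = (μₐ - μ_b)⁻¹ • (M - μ_b • 1)`.
[folklore] -/
theorem aeval_basisDivisor (M : Matrix n n 𝕜) (x y : 𝕜) :
    aeval M (basisDivisor x y) = (x - y)⁻¹ • (M - y • (1 : Matrix n n 𝕜)) := by
  rw [basisDivisor, map_mul, aeval_C, map_sub, aeval_X, aeval_C, Algebra.algebraMap_eq_smul_one,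
    Algebra.algebraMap_eq_smul_one, smul_mul_assoc, one_mul]

/-- **`Πₐ` as an explicit (ordered) product** of the commuting factors
`(μₐ - μ_b)⁻¹ • (M - μ_b • 1)`, `b ≠ a`, over any enumeration of `univ.erase a` — the form in
which smooth dependence on parameters is read off. [folklore] -/
theorem lagrangeProj_eq_list_prod (M : Matrix n n 𝕜) (μ : ι → 𝕜) (a : ι) :
    lagrangeProj M μ a =
      ((univ.erase a).toList.map fun b => (μ a - μ b)⁻¹ • (M - μ b • (1 : Matrix n n 𝕜))).prod := by
  unfold lagrangeProj Lagrange.basis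
  rw [← prod_map_toList, map_list_prod, List.map_map]
  congr 1
  refine List.map_congr_left fun b _ => ?_
  exact aeval_basisDivisor M (μ a) (μ b)

end Literature.LinearAlgebra.Matrix

end
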